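import Summits.BirchSwinnertonDyer.BirchSwinnertonDyer.Theses.SignedLowerHalves
import Summits.BirchSwinnertonDyer.BirchSwinnertonDyer.Theorems.SignedLowerHalvesKobayashiLowerHalfLargeImagePairedDescent
import HarnessLib

/-!
# Line `hilbert-door` — crux `KobayashiLowerHalfLargeImage` (route SignedLowerHalves, item
# stmt-BirchSwinnertonDyer-19001): the Burungale–Castella–Skinner QUARTIC-CM BASE CHANGE at `a_p = 0`

HONEST FRAMING (D-0152): this line feeds the CLASS route K3 = `SignedLowerHalves`; nothing here proves
BSD; every `stub_*` is `sorry`; the composition only shows that the stubs, if proved, give the crux BY NAME.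
Seat: planner-cruxidea-stmt-BirchSwinnertonDyer-19001-2-g5 (crux-ideate round 1, k = 2). The single
skeleton slot of the crux (`ledger skeleton check`) is NOT touched by this seat (lead's line stands).

THE LEVER. In the ORDINARY sibling, Burungale–Castella–Skinner (IMRN 2025 rnaf082 = arXiv:2405.00270v2,
Thm 1.1.2; tree: `Literature/…/CyclotomicIwasawaMainTheoremIrreducibleBaseChangeProofs.lean`, named fact
`BurungaleCastellaSkinner2025.display53_prod_charIdeal_le_prod_padicLFunction`) remove EVERY ramification
hypothesis from the Eisenstein half of Mazur's main conjecture — any conductor `N`, no Steinberg prime —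
by base change to a quartic CM field `M = FK` (`F` real quadratic, `K` imaginary quadratic) in which ALL
primes of `N` split (`𝔫⁻ = 1`), where Wan's three-variable Eisenstein-congruence divisibility over `M/F`
has only Fujiwara-type (`R = T`) hypotheses; Shapiro descent `M_∞ ⊇ FK_∞` turns it into the FOUR-FOLD
cyclotomic product divisibility (5.3) `(L_p(g) L_p(g_K) L_p(g_F) L_p(g_FK)) ⊇ ch X(g) ch X(g_K) ch X(g_F) ch X(g_FK)`,
and Kato's divisibility at the three twists separates the factor of `g` ("a proper divisibility in (5.4)
would contradict (5.3)"). At a good supersingular `p` with `a_p = 0` the X7 obstruction of record is EXACTLY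
a Steinberg-prime hypothesis: Fouquet–Wan's locus «∃ ℓ ∥ N non-split, ρ̄ ramified» / Wan's «∃ ℓ ∥ N, ε_ℓ = 1»,
and the D ∪ E ("shapeless") X7 pairs have NO multiplicative prime at all. This line ports the BCS
architecture to `a_p = 0`: the additive primes of an X7 curve are put into `𝔫⁺` (split in `M/F`, places where
`U(3,1)/F` is the split group `GL₄`), and NO Steinberg prime is asked for anywhere.

Stubs (3):
* `stub_signedDisplay53` — THE HARD STUB (OPEN; «BCS display (5.3) at a_p = 0»): for an X7 large-image
  pair `(W, p)`, `p ≥ 5`, `a_p = 0`, no CM, there are BCS discriminants `d_K < 0 < d_F` (Lemma 5.2.3 shape: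
  `≡ 1 (mod 4)`, squarefree, coprime, prime to `pN`, `p` split in `K`, every prime of `N` split in `K`) such
  that for all globally minimal models `W₁, W₂, W₃` of `E^{d_K}, E^{d_F}, E^{d_K d_F}` and every sign `ε`
  the FOUR-FOLD SIGNED product lower divisibility holds over `ℚ_∞`, in the currency of the route
  (`kobayashiL ε`, Pollack pairs, period ratios `ϖᵢ`, `SignedSelmerDualData`): `∏ gᵢ = (∏ ϖᵢ)·(∏ Lᵢ^ε)·h`.
  Source of truth in the ordinary case: BCS Prop 5.2.1 + (5.3); at `a_p = 0` its inputs become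
  (E1) a Wan-type `U(3,1)/F` Greenberg (±-free) Eisenstein divisibility for the base change `g_F` over `M = FK`
  with `𝔫⁻ = 1` (Wan, Algebra Number Theory 9 (2015) 1955–2054 constructs the Klingen–Eisenstein families on
  `U(r,s)` over totally real `F`; Wan ANT 14 (2020) / Castella–Wan / Fouquet–Wan arXiv:2107.13726 run the `U(3,1)`
  argument over `ℚ`; Hsieh (Doc. Math. 2014, tree `Hsieh2014/AnticyclotomicMuInvariantAnyLevel`) and Hida supply
  `μ = 0` over CM fields) — NOT IN PRINT over `F ≠ ℚ`; (E2) Shapiro descent to `K` (BCS Lemma 5.1.1 = SU14 Props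
  3.6–3.7, Cor 3.8: formal); (E3) the two-variable Greenberg ⟺ (ε,ε)-signed equivalence for the PAIR `(E, E^F)`
  over `K` (BSTW zeta element, BCS Cor 4.1.4 "opposite divisibility" at `a_p = 0`; both curves are elliptic
  curves over `ℚ`, trivial nebentypus) and signed control `Λ_K → Λ` (Kim / Kobayashi, `p` split in `K` so
  `K_𝔭 = ℚ_p`).
* `stub_quartetDoor` — the FOUR-FOLD DOOR (size M, published inputs only): the four-fold signed product lower
  divisibility + Kato–Kobayashi's upper inclusion (Kobayashi 2003 Thm 1.3/4.1, integral under surjectivity) at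
  the three twists (good at `p`, `a_p = 0`, `ρ̄` onto by `twist_sideConditions`) + Pollack's `L^ε ≠ 0` + the
  period units `ϖᵢ ∈ ℤ_(p)ˣ` ⇒ `KobayashiLowerDivisibility W p ε`. It is the tree's quadratic door
  `kobayashiLowerDivisibility_of_paired` with three partners instead of one, and the `a_p = 0` transcription of
  the tree theorem `burungale_castella_skinner_charIdeal_eq_padicLFunction_of_baseChange_divisibility`
  (pure algebra `exists_span_eq_and_map_eq_C_zpow_mul_of_prod_mem` over `Fin 4`).
* `stub_three` — honest residue `p = 3` (Wan-type Eisenstein congruences and Fujiwara's `R = T` are printed for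
  `p > 3`; BCS §1.5: «the strategy also applies for p = 3» modulo a period comparison).
Composition: `lowerHalf_of_stubs` (explicit, from the three stub STATEMENTS: an odd prime is `3` or `≥ 5`; at
`p ≥ 5` take the BCS discriminants of `stub_signedDisplay53`, the sign `ε = 1`, and open the door) and
`KobayashiLowerHalfLargeImage_of : <the crux>` = it applied to the three registered stubs.
-/

set_option autoImplicit false
set_option linter.dupNamespace false

noncomputable section

open scoped Classical MatrixGroups ModularForm

open CongruenceSubgroup WeierstrassCurve Literature.NumberTheory.EllipticCurves
  Literature.NumberTheory.EllipticCurves.ModularForms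
  Literature.NumberTheory.EllipticCurves.Rank1Residual
  Literature.NumberTheory.EllipticCurves.Rank1Residual.Typed
  Literature.NumberTheory.EllipticCurves.Kobayashi2003 ZpExtension
  Summit.BirchSwinnertonDyer.Rank1Residual.Supersingular
  Summit.BirchSwinnertonDyer.BirchSwinnertonDyer.Theorems

namespace Summit.BirchSwinnertonDyer.BirchSwinnertonDyer.Cruxes.KobayashiLowerHalfLargeImage

namespace HilbertDoor

/-- **BCS discriminants for `(W, p)`** (Lemma 5.2.3 shape, the typable part): `d_K < 0 < d_F`, both
`≡ 1 (mod 4)` and squarefree, `d_K ≠ -3` (disc), `(d_K, d_F) = 1`, `(d_K d_F, pN) = 1`, `p` SPLIT in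
`K = ℚ(√d_K)` (spl), every prime of `d_F` split in `K` (Prop 5.2.1 (ii)) and every odd prime of `N` split in
`K` (Heeg). The Galois-theoretic conditions of BCS
Prop 5.2.1 ((irr_M), (v)) and the `a_p = 0` analogue of its condition (iii) on `F` have no tree vocabulary and
are left to the prover's choice inside the `∃` of `SignedDisplay53Statement` (this only weakens what is
recorded, not its use by the door). [cite: BurungaleCastellaSkinner2025, Lemma 5.2.3 and Prop. 5.2.1 (pp. 9–10 of arXiv:2405.00270v2)] -/
def IsBCSDiscriminantPair (W : WeierstrassCurve ℚ) [W.IsElliptic] (p : ℕ) (dK dF : ℤ) : Prop :=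
  dK < 0 ∧ dK % 4 = 1 ∧ Squarefree dK ∧ dK ≠ -3 ∧
  1 < dF ∧ dF % 4 = 1 ∧ Squarefree dF ∧ IsCoprime dK dF ∧
  IsCoprime (dK * dF) ((p * W.conductorNorm ℤ : ℕ) : ℤ) ∧
  IsSquare ((dK : ZMod p)) ∧
  (∀ ℓ : ℕ, ℓ.Prime → (ℓ : ℤ) ∣ dF → IsSquare ((dK : ZMod ℓ))) ∧
  ∀ ℓ : ℕ, ℓ.Prime → ℓ ∣ W.conductorNorm ℤ → ℓ ≠ 2 → IsSquare ((dK : ZMod ℓ))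

/-- **The FOUR-FOLD signed product lower divisibility for `W` at `(p, ε)` with discriminants `(d_K, d_F)`**
— «BCS display (5.3) at `a_p = 0`» in the route's currency. For every cyclotomic `κ` with generator `γ`
matching Pollack's variable, all globally minimal models `W₁, W₂, W₃` of `W^{(d_K)}, W^{(d_F)}, W^{(d_K d_F)}`,
the newforms `f, f₁, f₂, f₃` (at the conductor levels), period ratios `ϖᵢ·Ω_{Wᵢ} = Ω⁺_{fᵢ}`, Pollack pairs,
and Pontryagin-dual data of the signed Selmer groups `X^ε(Wᵢ/ℚ_∞)` over the SAME `(κ, γ)`: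
`char X^ε(Wᵢ) = (gᵢ)` and `ι(g g₁ g₂ g₃) = (ϖϖ₁ϖ₂ϖ₃) · ι(L^ε L₁^ε L₂^ε L₃^ε · h)` for some `h ∈ Λ`, i.e.
`∏ Lᵢ^ε ∣ ∏ char X^ε(Wᵢ)` (LOWER: Selmer bounded from below). It is `PairedKobayashiLowerDivisibility` with
four factors; implied by `KobayashiLowerDivisibility` at the four curves; asserted by nobody in print at a
non-ordinary `p` (its ordinary twin is the tree's named fact `display53_prod_charIdeal_le_prod_padicLFunction`).
[cite: BurungaleCastellaSkinner2025, display (5.3) (p. 10 of arXiv:2405.00270v2) (shape only; ordinary case)]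
[cite: Kobayashi2003, Conjecture (Main Conjecture) (p. 2) (shape only; nothing asserted)] -/
def QuartetSignedLowerDivisibility (W : WeierstrassCurve ℚ) [W.IsElliptic] [W.IsGloballyMinimal]
    (p : ℕ) [Fact p.Prime] (ε : ℤˣ) (dK dF : ℤ) : Prop :=
  ∀ (κ : ZpExtension ℚ p) (γ : Field.absoluteGaloisGroup ℚ),
      κ.IsCyclotomic → κ.IsTopGenerator γ → IsCyclotomicVariable p γ →
    ∀ (W₁ W₂ W₃ : WeierstrassCurve ℚ) [W₁.IsElliptic] [W₁.IsGloballyMinimal]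
      [W₂.IsElliptic] [W₂.IsGloballyMinimal] [W₃.IsElliptic] [W₃.IsGloballyMinimal],
      (∃ C : VariableChange ℚ, C • W₁ = W.quadraticTwist (dK : ℚ)) →
      (∃ C : VariableChange ℚ, C • W₂ = W.quadraticTwist (dF : ℚ)) →
      (∃ C : VariableChange ℚ, C • W₃ = W.quadraticTwist ((dK * dF : ℤ) : ℚ)) →
    ∀ [NeZero (W.conductorNorm ℤ)] (f : CuspForm (Gamma0 (W.conductorNorm ℤ)) 2),
      IsNewformOf W f → ∀ (ϖ : ℚ), (ϖ : ℝ) * W.realPeriodRat = plusPeriod f →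
    ∀ (Lplus Lminus : IwasawaAlgebra p), IsPollackPair f p Lplus Lminus →
    ∀ (D : SignedSelmerDualData W κ γ ε),
    ∀ [NeZero (W₁.conductorNorm ℤ)] (f₁ : CuspForm (Gamma0 (W₁.conductorNorm ℤ)) 2),
      IsNewformOf W₁ f₁ → ∀ (ϖ₁ : ℚ), (ϖ₁ : ℝ) * W₁.realPeriodRat = plusPeriod f₁ →
    ∀ (Lplus₁ Lminus₁ : IwasawaAlgebra p), IsPollackPair f₁ p Lplus₁ Lminus₁ →
    ∀ (D₁ : SignedSelmerDualData W₁ κ γ ε),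
    ∀ [NeZero (W₂.conductorNorm ℤ)] (f₂ : CuspForm (Gamma0 (W₂.conductorNorm ℤ)) 2),
      IsNewformOf W₂ f₂ → ∀ (ϖ₂ : ℚ), (ϖ₂ : ℝ) * W₂.realPeriodRat = plusPeriod f₂ →
    ∀ (Lplus₂ Lminus₂ : IwasawaAlgebra p), IsPollackPair f₂ p Lplus₂ Lminus₂ →
    ∀ (D₂ : SignedSelmerDualData W₂ κ γ ε),
    ∀ [NeZero (W₃.conductorNorm ℤ)] (f₃ : CuspForm (Gamma0 (W₃.conductorNorm ℤ)) 2),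
      IsNewformOf W₃ f₃ → ∀ (ϖ₃ : ℚ), (ϖ₃ : ℝ) * W₃.realPeriodRat = plusPeriod f₃ →
    ∀ (Lplus₃ Lminus₃ : IwasawaAlgebra p), IsPollackPair f₃ p Lplus₃ Lminus₃ →
    ∀ (D₃ : SignedSelmerDualData W₃ κ γ ε),
      ∃ g g₁ g₂ g₃ h : IwasawaAlgebra p,
        D.charIdeal = Ideal.span {g} ∧ D₁.charIdeal = Ideal.span {g₁} ∧
        D₂.charIdeal = Ideal.span {g₂} ∧ D₃.charIdeal = Ideal.span {g₃} ∧
        iwasawaToPowerSeries p (g * g₁ * g₂ * g₃) =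
          PowerSeries.C ((ϖ * ϖ₁ * ϖ₂ * ϖ₃ : ℚ) : ℚ_[p]) *
            iwasawaToPowerSeries p
              (kobayashiL ε Lplus Lminus * kobayashiL ε Lplus₁ Lminus₁ *
                kobayashiL ε Lplus₂ Lminus₂ * kobayashiL ε Lplus₃ Lminus₃ * h)

/-- Statement of THE HARD STUB «BCS display (5.3) at `a_p = 0`» on the large-image corner of X7: BCS
discriminants exist for which the four-fold signed product lower divisibility holds for every sign. -/
def SignedDisplay53Statement : Prop :=
  ∀ (W : WeierstrassCurve ℚ) [W.IsElliptic] [W.IsGloballyMinimal] (p : ℕ) [Fact p.Prime],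
    5 ≤ p → ClassX7 W p → ¬ W.HasCM → W.frobeniusTrace p = 0 → Surj W p →
    ∃ dK dF : ℤ, IsBCSDiscriminantPair W p dK dF ∧
      ∀ ε : ℤˣ, QuartetSignedLowerDivisibility W p ε dK dF

/-- Statement of the FOUR-FOLD DOOR: published Kato-side inputs at the three twists separate the factor of
`W` from the four-fold signed product lower divisibility. -/
def QuartetDoorStatement : Prop :=
  ∀ (W : WeierstrassCurve ℚ) [W.IsElliptic] [W.IsGloballyMinimal] (p : ℕ) [Fact p.Prime] (ε : ℤˣ)
    (dK dF : ℤ), p ≠ 2 → GoodSS W p → W.frobeniusTrace p = 0 → Surj W p →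
    IsBCSDiscriminantPair W p dK dF → QuartetSignedLowerDivisibility W p ε dK dF →
    KobayashiLowerDivisibility W p ε

/-- Statement of the residue `p = 3`. -/
def ThreeStatement : Prop :=
  ∀ (W : WeierstrassCurve ℚ) [W.IsElliptic] [W.IsGloballyMinimal] (p : ℕ) [Fact p.Prime],
    p = 3 → ClassX7 W p → ¬ W.HasCM → W.frobeniusTrace p = 0 → Surj W p →
    ∃ ε : ℤˣ, KobayashiLowerDivisibility W p ε

/-- THE HARD STUB (OPEN) — «BCS display (5.3) at `a_p = 0`»: the output, on the cyclotomic line, of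
(E1) a Wan-type `U(3,1)/F` Greenberg-type Eisenstein divisibility for the base change `g_F` of the newform
of `W` over the CM quartic `M = FK` with `𝔫⁻ = 1` (every prime of `N` split in `M/F`), (E2) Shapiro descent
to `K`, (E3) the two-variable Greenberg ⟺ signed equivalence for the pair `(E, E^F)` over `K` and signed
control `Λ_K → Λ`. Printed at ordinary `p` (BCS Prop 5.2.1 + (5.3)); (E1) is NOT in print over `F ≠ ℚ`
at a non-ordinary `p` — it is the first non-transferring step of the ordinary sibling's proof.
[cite: BurungaleCastellaSkinner2025, Prop. 5.2.1, Lemma 5.2.3, display (5.3) (pp. 9–10 of arXiv:2405.00270v2)] -/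
theorem stub_signedDisplay53 : SignedDisplay53Statement := by
  sorry

/-- THE FOUR-FOLD DOOR (published inputs only; size M): Kobayashi 2003 Thm 1.2 / Thm 4.1 (integral under
surjectivity: Serre `p ≥ 5`) at the three twists `W₁, W₂, W₃` — good at `p` with `a_p = 0` and `ρ̄` onto
by `twist_sideConditions` since `p ∤ 2 d_K d_F` —, Pollack's `Lᵢ^ε ≠ 0`, the period units
`ϖᵢ ∈ ℤ_(p)ˣ` (`realPeriodRat_eq_unit_mul_plusPeriod`), modularity for the newforms of the twists, existence
of signed dual data; then cancel `ι(g₁ g₂ g₃) ≠ 0` exactly as in `kobayashiLowerDivisibility_of_paired`.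
[cite: Kobayashi2003, Thm. 1.2 (p. 2), Thm. 4.1 (p. 8)] [cite: Pollack2003, Cor. 5.11]
[cite: BurungaleCastellaSkinner2025, "Proof of Theorem 1.1.2" (p. 10 of arXiv:2405.00270v2)] -/
theorem stub_quartetDoor : QuartetDoorStatement := by
  sorry

/-- RESIDUE `p = 3` (honest): the crux's conclusion at the prime `3` (X7 with `a_3 = 0`, large image, no
CM); the Eisenstein-congruence and `R = T` inputs of the Hilbert door are printed for `p > 3` only. -/
theorem stub_three : ThreeStatement := by
  sorry

/-- COMPOSITION, explicit form (bookkeeping; conclusion = the crux UNFOLDED): an odd prime is `3` or `≥ 5`;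
at `p ≥ 5` the hard stub supplies BCS discriminants and the four-fold signed lower divisibility for the sign
`+1`, and the door separates the factor of `W`. -/
theorem lowerHalf_of_stubs (hE : SignedDisplay53Statement) (hD : QuartetDoorStatement)
    (h3 : ThreeStatement) :
    ∀ (W : WeierstrassCurve ℚ) [W.IsElliptic] [W.IsGloballyMinimal] (p : ℕ) [Fact p.Prime],
      p ≠ 2 → ClassX7 W p → ¬ W.HasCM → W.frobeniusTrace p = 0 → Surj W p →
      ∃ ε : ℤˣ, KobayashiLowerDivisibility W p ε := by
  intro W _ _ p _ hp2 hX hcm hap hs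
  have hpP : p.Prime := Fact.out
  by_cases hp5 : 5 ≤ p
  · obtain ⟨dK, dF, hadm, hquart⟩ := hE W p hp5 hX hcm hap hs
    exact ⟨1, hD W p 1 dK dF hp2 hX.1 hap hs hadm (hquart 1)⟩
  · have hp3 : p = 3 := by
      have h2 := hpP.two_le
      interval_cases p
      · exact absurd rfl hp2
      · rfl
      · exact absurd hpP (by decide)
    exact h3 W p hp3 hX hcm hap hs

/-- THE SKELETON: the crux BY NAME from exactly the three registered stubs (no sorry of its own; the stubs'
`sorry`s are the line's open obligations). -/
theorem KobayashiLowerHalfLargeImage_of :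
    Summit.BirchSwinnertonDyer.BirchSwinnertonDyer.Theses.SignedLowerHalves.KobayashiLowerHalfLargeImage :=
  lowerHalf_of_stubs stub_signedDisplay53 stub_quartetDoor stub_three

/-! ### Sanity anchors (proved): the four-fold relation is never stronger than the four lower halves, and
the abstract `n`-factor door over a domain. -/

/-- The abstract door: in a commutative domain, if each `C i` divides `L i` (Kato side at every factor), the
product of the `L i` divides the product of the `C i` (Eisenstein side for the product) and the product of
the `C i` is non-zero, then every `C i` is associated to `L i`. -/
theorem associated_of_dvd_of_prod_dvd_prod {R : Type*} [CommRing R] [IsDomain R] {ι : Type*}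
    (s : Finset ι) (C L : ι → R) (hK : ∀ i ∈ s, C i ∣ L i)
    (hE : (∏ i ∈ s, L i) ∣ (∏ i ∈ s, C i)) (h0 : (∏ i ∈ s, C i) ≠ 0) :
    ∀ i ∈ s, Associated (C i) (L i) := by
  classical
  -- choose the cofactors
  choose k hk using hK
  have hprod : (∏ i ∈ s, L i) = (∏ i ∈ s, C i) * ∏ i ∈ s.attach, k i.1 i.2 := by
    rw [← Finset.prod_attach s (f := L), ← Finset.prod_attach s (f := C), ← Finset.prod_mul_distrib]
    exact Finset.prod_congr rfl fun i _ => hk i.1 i.2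
  -- the product of the cofactors is a unit
  obtain ⟨u, hu⟩ := hE
  have hunit : IsUnit (∏ i ∈ s.attach, k i.1 i.2) := by
    have h1 : (∏ i ∈ s, C i) * ((∏ i ∈ s.attach, k i.1 i.2) * u) = (∏ i ∈ s, C i) * 1 := by
      rw [mul_one, ← mul_assoc, ← hprod, ← hu]
    have h2 := mul_left_cancel₀ h0 h1
    exact isUnit_iff_exists_inv.mpr ⟨u, h2⟩
  intro i hi
  have hki : IsUnit (k i hi) := by
    have hmem : (⟨i, hi⟩ : {x // x ∈ s}) ∈ s.attach := Finset.mem_attach s ⟨i, hi⟩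
    exact isUnit_of_dvd_unit (Finset.dvd_prod_of_mem (fun j : {x // x ∈ s} => k j.1 j.2) hmem) hunit
  exact ⟨hki.unit, by rw [IsUnit.unit_spec, ← hk i hi]⟩

end HilbertDoor

end Summit.BirchSwinnertonDyer.BirchSwinnertonDyer.Cruxes.KobayashiLowerHalfLargeImage
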